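import Mathlib
import Summits.Ventures.HodgeRepro.Tier4.Target
import Summits.Ventures.HodgeRepro.Tier4.LitCompactness
import Summits.Ventures.HodgeRepro.Tier4.Line3.Defs
import Summits.Ventures.HodgeRepro.Tier4.Line3.LocaliserS
import Summits.Ventures.HodgeRepro.Tier4.Line3.BallCoordLemmas
import Summits.Ventures.HodgeRepro.Tier4.Line3.InvariantClassBound
import Summits.Ventures.HodgeRepro.Tier4.Line3.InvariantRouteFinal

/-!
# Tier4/Line3/TermDominatedSkel — L3.5 `term_dominated` in the SKELETON'S binders (+ `hinv`, `hlit`)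

Blind re-derivation cell `pub-hodge-repro`, Tier 4 «PROVE THE STEP» (README §9–§10), LINE L3, seat t4-L2-p3 (gen 2).
`term_dominated_skel` is the v0.31 statement of L3.5 (Skeleton-v0.31.lean L318–L326: binders `D {p} {L₀} {xm} hL h02
h13 hab ℓ`, the ball-coordinate wedge form of `hab`) with the two hypotheses the invariant route displays appended —
`hinv : GrowthInv D p L₀ xm ℓ` (the localiser's invariant growth clause, to become a field of `LocSI` in v0.34,
t4-plan-3 S12986) and `hlit` (the skeleton's printed input, displayed on `P_of_line_pos`).  The wedge form of `hab`
is turned into `LinearIndependent X.E ![xm 0, xm 1]` by t4-x2's `linearIndependent_of_ballWedge`; `hL` is not used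
(kept so that the statement is the skeleton's).  So v0.34 may write `term_dominated := X.term_dominated_skel D hL h02
h13 hab ℓ ℓ.growthInv hlit`.  Nothing here asserts anything about the truth of (P); HC_CM is NOT proved by anyone in
this repository.
-/

set_option autoImplicit false

noncomputable section

namespace Summit.Ventures.HodgeRepro.Tier4.Line3

open Summit.Ventures.HodgeRepro.Tier4
open NumberField

namespace T4Data

variable (X : T4Data)

/-- **L3.5 IN THE SKELETON'S BINDERS**, with the invariant growth clause and the BHC domain displayed. -/
theorem term_dominated_skel (D : X.ThetaData) {p : IsDedekindDomain.HeightOneSpectrum (RingOfIntegers X.E)}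
    {L₀ : Submodule (RingOfIntegers X.E) (Fin 3 → X.E)} {xm : X.Tuple} (_hL : X.IsLattice L₀)
    (h02 : xm 2 = xm 0) (h13 : xm 3 = xm 1)
    (hab : X.ballCoord (xm 0) 0 * X.ballCoord (xm 1) 1 - X.ballCoord (xm 0) 1 * X.ballCoord (xm 1) 0 ≠ 0)
    (ℓ : X.LocS D p L₀ xm) (hinv : X.GrowthInv D p L₀ xm ℓ)
    (hlit : Lit.BorelHarishChandra1962_Thm11_8_fundamentalDomain_hdef X.E X.H X.τ₀ X.C) :
    ∃ bound : X.Orbit → ℝ, (∀ o, 0 ≤ bound o) ∧ Summable bound ∧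
      ∀ N (o : X.Orbit), o ≠ X.orbitOf (X.lines xm) → ‖X.term D.Φ D.cf (ℓ.level N) (ℓ.loc N) o‖ ≤ bound o :=
  X.term_dominated_of_growthInv_lit D p L₀ xm h02 h13 (X.linearIndependent_of_ballWedge hab) ℓ hinv hlit

end T4Data

end Summit.Ventures.HodgeRepro.Tier4.Line3

end
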